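import Mathlib
import Summits.Schanuel.Schanuel.Theses.RigidCore
import Summits.Schanuel.Schanuel.Theorems.RigidCoreMinimalCounterexampleInAclLogSector
import Summits.Schanuel.Schanuel.Theorems.RigidCoreMinimalCounterexampleInAclAclCriterion
import Summits.Schanuel.Schanuel.Theorems.RigidCoreMinimalCounterexampleInAclGlTransport
import Summits.Schanuel.Schanuel.Theorems.RigidCoreMinimalCounterexampleInAclMixedFrame
import Summits.Schanuel.Schanuel.Theorems.RigidCoreMinimalCounterexampleInAclCellSelectors

/-!
# (S*) in ranks ≥ 3 — the SECTOR SPLIT of item stmt-Schanuel-14744 (crux stmt-Schanuel-0969 `RigidCore.MinimalCounterexampleInAcl`)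

Line `kernel-arithmetic-selection` (lead prover-line-stmt-Schanuel-0969-c5-0), `--supports stmt-Schanuel-0969`; structure theorem for the
registered stub `stub_geThree` (= item 14744 `MinimalCounterexampleInAclGeThree` verbatim), the every-rank analogue of the rank-2 splits
`RankSplit` / `PureSplit`.

By the MIXED-LATTICE NORMAL FORM (`stub_mixedFrame`: the lattice `{M : e^{M·x} ∈ ℚ̄}` of any tuple is saturated, hence spanned by the first
`r` rows of some `A ∈ GL_n(ℤ)`, the tuple being pure in the remaining directions) and `GL_n(ℤ)` TRANSPORT of first failures
(`stub_glTransport`), item 14744 is equivalent to its restriction to first failures in NORMAL FORM of MIXED RANK `r < n`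
(`e^{x_j} ∈ ℚ̄` for `j < r`, `e^{M·x} ∉ ℚ̄` whenever `M` has a non-zero entry at an index `≥ r`); mixed rank `r = n` is the LOG SECTOR, a
theorem at every rank (`stub_cruxLogSector`):

* `geThree_iff_normalForm` — 14744 ⟺ (S*) for normal-form first failures of rank `n ≥ 3` and mixed rank `r < n`;
* `geThree_iff_corankSplit` — 14744 ⟺ [CORANK ONE: `r = n − 1`] ∧ [CORANK ≥ 2: `r ≤ n − 2`];
* `corankOne_of_cellRecurrence` — the corank-one half follows from CELL-RECURRENCE FINITENESS of the joint value set
  `{(x'_0, …, x'_{n−2}) : x' mate}` (Theorems/…CellSelectors, `mem_expAcl_of_corankOne_cellRecurrence`), the input the `window-cells`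
  approach to 14744 must supply; the corank ≥ 2 half contains a relative pure-sector problem (no kernel torsor in ≥ 2 directions).

References: [Kirby2010] J. Kirby, *Exponential algebraicity in exponential fields*, Bull. LMS 42 (2010), arXiv:0810.4285, Prop. 7.2;
[KirbyMacintyreOnshuus2012] J. Kirby, A. Macintyre, A. Onshuus, J. Inst. Math. Jussieu 11 (2012), arXiv:1101.4224, §2.
-/

noncomputable section

set_option linter.dupNamespace false

open Complex Set FirstOrder

namespace Summit.Schanuel.Schanuel.Cruxes.MinimalCounterexampleInAcl.KernelArithmeticSelection

open Literature.NumberTheory.Transcendental (SchanuelRank)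
open Literature.ModelTheory.ExponentialFields
open Summit.Schanuel.Schanuel.Theorems.AclSubsetLogFreeCore.Negative

variable {n : ℕ}

/-! ## Normal form of mixed rank `r` -/

/-- (S*) for a first failure transported to normal form: if `A * B = 1`, `y = A·x`, and every coordinate of `y` is in `acl(∅)`, then so is
every coordinate of `x` (re-export of the transport stub in curried form). [cite: Kirby2010, Prop. 7.2] -/
theorem expAcl_of_frame {x : Fin n → ℂ} (hx : x ∈ firstFailures n) {A B : Matrix (Fin n) (Fin n) ℤ} (hAB : A * B = 1)
    (hy : ∀ i, (∑ j, (A i j : ℂ) * x j) ∈ expAcl) : ∀ i, x i ∈ expAcl :=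
  (stub_glTransport n x A B hAB hx).2.2 hy

/-- **Item 14744 ⟺ its restriction to NORMAL-FORM first failures of mixed rank `r < n`.**  (→) is specialisation.  (←): put a first
failure `x` of rank `n ≥ 3` in normal form `y = A·x` (`stub_mixedFrame`), a first failure with the same field (`stub_glTransport`); if its
mixed rank is `n` every `e^{y_i}` is algebraic and the log-sector theorem `stub_cruxLogSector` applies, otherwise the hypothesis; transport
back. [cite: Kirby2010, Prop. 7.2] -/
theorem geThree_iff_normalForm :
    Summit.Schanuel.Schanuel.Theses.RigidCore.MinimalCounterexampleInAclGeThree ↔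
      ∀ (n r : ℕ), 3 ≤ n → r < n → ∀ x : Fin n → ℂ, x ∈ firstFailures n →
        (∀ i : Fin n, (i : ℕ) < r → IsAlgebraic ℚ (cexp (x i))) →
        (∀ M : Fin n → ℤ, (∃ i : Fin n, r ≤ (i : ℕ) ∧ M i ≠ 0) → Transcendental ℚ (cexp (∑ i, (M i : ℂ) * x i))) →
        ∀ i, x i ∈ expAcl := by
  constructor
  · intro h n r h3 _ x hx _ _ i
    exact h n h3 x hx.1 hx.2.1 hx.2.2 i
  · intro H n h3 x hxli htr hSR i
    have hx : x ∈ firstFailures n := ⟨hxli, htr, hSR⟩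
    obtain ⟨A, B, r, hAB, hrn, halg, hpure⟩ := stub_mixedFrame n x
    obtain ⟨hy, -, hacl⟩ := stub_glTransport n x A B hAB hx
    refine hacl ?_ i
    rcases hrn.eq_or_lt with rfl | hr
    · -- mixed rank `n`: the log sector
      intro i
      exact stub_cruxLogSector _ _ hy (fun i => halg i i.isLt) i
    · exact H n r h3 hr _ hy halg hpure

/-! ## Corank split -/

/-- **Item 14744 ⟺ [corank one] ∧ [corank ≥ 2]** (normal form of mixed rank `r = n − 1`, resp. `r ≤ n − 2`). [cite: Kirby2010, Prop. 7.2] -/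
theorem geThree_iff_corankSplit :
    Summit.Schanuel.Schanuel.Theses.RigidCore.MinimalCounterexampleInAclGeThree ↔
      ((∀ m : ℕ, 2 ≤ m → ∀ x : Fin (m + 1) → ℂ, x ∈ firstFailures (m + 1) →
          (∀ i : Fin (m + 1), (i : ℕ) < m → IsAlgebraic ℚ (cexp (x i))) →
          (∀ M : Fin (m + 1) → ℤ, M (Fin.last m) ≠ 0 → Transcendental ℚ (cexp (∑ i, (M i : ℂ) * x i))) →
          ∀ i, x i ∈ expAcl) ∧
        ∀ (n r : ℕ), 3 ≤ n → r + 2 ≤ n → ∀ x : Fin n → ℂ, x ∈ firstFailures n →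
          (∀ i : Fin n, (i : ℕ) < r → IsAlgebraic ℚ (cexp (x i))) →
          (∀ M : Fin n → ℤ, (∃ i : Fin n, r ≤ (i : ℕ) ∧ M i ≠ 0) → Transcendental ℚ (cexp (∑ i, (M i : ℂ) * x i))) →
          ∀ i, x i ∈ expAcl) := by
  rw [geThree_iff_normalForm]
  constructor
  · intro H
    refine ⟨fun m hm x hx halg hpure => H (m + 1) m (by omega) (by omega) x hx halg ?_, fun n r h3 hr x hx => H n r h3 (by omega) x hx⟩
    rintro M ⟨i, hri, hMi⟩
    have hi : i = Fin.last m := Fin.eq_last_of_not_lt (by simpa using hri) |> id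
    exact hpure M (hi ▸ hMi)
  · rintro ⟨H1, H2⟩ n r h3 hr x hx halg hpure
    by_cases h : r + 2 ≤ n
    · exact H2 n r h3 h x hx halg hpure
    · -- corank one: `n = r + 1`
      obtain ⟨m, rfl⟩ : ∃ m, n = m + 1 := ⟨n - 1, by omega⟩
      have hrm : r = m := by omega
      subst hrm
      refine H1 r (by omega) x hx halg fun M hM => hpure M ⟨Fin.last r, ?_, hM⟩
      simp

/-- **The corank-one half of item 14744 from CELL-RECURRENCE FINITENESS.**  If for every normal-form first failure `x` of rank `m + 1 ≥ 3`
and mixed rank `m` (all `e^{x_k}`, `k < m`, algebraic) cells of every large size recur at finitely many positions of the joint value set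
`{(x'_k)_{k<m} : x' ∈ locusMates x}`, then (S*) holds on the corank-one sector (`mem_expAcl_of_corankOne_cellRecurrence` with the
coordinate directions `e_0, …, e_{m−1}` and the acl-criterion). [cite: KirbyMacintyreOnshuus2012, §2] -/
theorem corankOne_of_cellRecurrence
    (hrec : ∀ m : ℕ, 2 ≤ m → ∀ x : Fin (m + 1) → ℂ, x ∈ firstFailures (m + 1) →
      (∀ i : Fin (m + 1), (i : ℕ) < m → IsAlgebraic ℚ (cexp (x i))) →
      ∃ L : ℕ, ∀ G : Finset (Fin m → ℤ), L ≤ G.card →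
        Set.Finite {v : Fin m → ℂ | ∀ g ∈ G, (fun k => v k + 2 * ↑Real.pi * I * (g k : ℂ)) ∈
          {v : Fin m → ℂ | ∃ x' ∈ locusMates x, ∀ k, v k = x' (Fin.castSucc k)}}) :
    ∀ m : ℕ, 2 ≤ m → ∀ x : Fin (m + 1) → ℂ, x ∈ firstFailures (m + 1) →
      (∀ i : Fin (m + 1), (i : ℕ) < m → IsAlgebraic ℚ (cexp (x i))) →
      (∀ M : Fin (m + 1) → ℤ, M (Fin.last m) ≠ 0 → Transcendental ℚ (cexp (∑ i, (M i : ℂ) * x i))) →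
      ∀ i, x i ∈ expAcl := by
  classical
  intro m hm x hx halg _
  -- the coordinate directions `e_{castSucc k}`
  set M : Fin m → Fin (m + 1) → ℤ := fun k => Pi.single (Fin.castSucc k) (1 : ℤ) with hM
  have hsum : ∀ (k : Fin m) (z : Fin (m + 1) → ℂ), (∑ i, (M k i : ℂ) * z i) = z (Fin.castSucc k) := by
    intro k z
    rw [Finset.sum_eq_single (Fin.castSucc k)]
    · simp [hM]
    · intro b _ hb
      simp [hM, hb]
    · intro h; exact absurd (Finset.mem_univ _) h
  have hli : LinearIndependent ℚ (fun k => ∑ i, (M k i : ℂ) * x i) := by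
    have e : (fun k => ∑ i, (M k i : ℂ) * x i) = x ∘ Fin.castSucc := funext fun k => hsum k x
    rw [e]
    exact hx.1.comp _ (Fin.castSucc_injective m)
  have halg' : ∀ k : Fin m, IsAlgebraic ℚ (cexp (∑ i, (M k i : ℂ) * x i)) := fun k => by
    rw [hsum]; exact halg _ (by simp)
  refine mem_expAcl_of_corankOne_cellRecurrence hx rfl M hli halg' ?_
  obtain ⟨L, hL⟩ := hrec m hm x hx halg
  refine ⟨L, fun G hG => ?_⟩
  have e : {v : Fin m → ℂ | ∃ x' ∈ locusMates x, ∀ k, v k = ∑ i, (M k i : ℂ) * x' i} =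
      {v : Fin m → ℂ | ∃ x' ∈ locusMates x, ∀ k, v k = x' (Fin.castSucc k)} := by
    ext v; simp only [Set.mem_setOf_eq, hsum]
  rw [e]
  exact hL G hG

/-- **Item 14744 from cell recurrence on the corank-one sector and (S*) on the sectors of corank ≥ 2** (composition of the two previous
theorems). [cite: Kirby2010, Prop. 7.2] -/
theorem geThree_of_cellRecurrence_of_corankGeTwo
    (hrec : ∀ m : ℕ, 2 ≤ m → ∀ x : Fin (m + 1) → ℂ, x ∈ firstFailures (m + 1) →
      (∀ i : Fin (m + 1), (i : ℕ) < m → IsAlgebraic ℚ (cexp (x i))) →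
      ∃ L : ℕ, ∀ G : Finset (Fin m → ℤ), L ≤ G.card →
        Set.Finite {v : Fin m → ℂ | ∀ g ∈ G, (fun k => v k + 2 * ↑Real.pi * I * (g k : ℂ)) ∈
          {v : Fin m → ℂ | ∃ x' ∈ locusMates x, ∀ k, v k = x' (Fin.castSucc k)}})
    (h2 : ∀ (n r : ℕ), 3 ≤ n → r + 2 ≤ n → ∀ x : Fin n → ℂ, x ∈ firstFailures n →
      (∀ i : Fin n, (i : ℕ) < r → IsAlgebraic ℚ (cexp (x i))) →
      (∀ M : Fin n → ℤ, (∃ i : Fin n, r ≤ (i : ℕ) ∧ M i ≠ 0) → Transcendental ℚ (cexp (∑ i, (M i : ℂ) * x i))) →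
      ∀ i, x i ∈ expAcl) :
    Summit.Schanuel.Schanuel.Theses.RigidCore.MinimalCounterexampleInAclGeThree :=
  geThree_iff_corankSplit.2 ⟨corankOne_of_cellRecurrence hrec, h2⟩

/-! ## Registered form (fully qualified; `ledger workitem stub-add stmt-Schanuel-0969 --name stub_geThree_iff_normalForm …`) -/

/-- Registered form of `geThree_iff_normalForm` (stub `stub_geThree_iff_normalForm` of crux stmt-Schanuel-0969, line kernel-arithmetic-selection,
lead c5): item 14744 ⟺ (S*) for normal-form first failures of mixed rank `r < n`. -/
theorem stub_geThree_iff_normalForm : Summit.Schanuel.Schanuel.Theses.RigidCore.MinimalCounterexampleInAclGeThree ↔ ∀ (n r : ℕ), 3 ≤ n → r < n → ∀ x : Fin n → ℂ, x ∈ Summit.Schanuel.Schanuel.Cruxes.MinimalCounterexampleInAcl.KernelArithmeticSelection.firstFailures n → (∀ i : Fin n, (i : ℕ) < r → IsAlgebraic ℚ (Complex.exp (x i))) → (∀ M : Fin n → ℤ, (∃ i : Fin n, r ≤ (i : ℕ) ∧ M i ≠ 0) → Transcendental ℚ (Complex.exp (∑ i, (M i : ℂ) * x i))) → ∀ i, x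 i ∈ Summit.Schanuel.Schanuel.Theorems.AclSubsetLogFreeCore.Negative.expAcl :=
  geThree_iff_normalForm

end Summit.Schanuel.Schanuel.Cruxes.MinimalCounterexampleInAcl.KernelArithmeticSelection

end
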